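import Summits.CriticalPhenomena.PercolationContinuityZ3.Theorems.PercNearOneGluingNoHeavyLowerTailSunflowerMultiPetalUpperOnePetal
import Summits.CriticalPhenomena.PercolationContinuityZ3.Theorems.PercNearOneGluingNoHeavyLowerTailSunflowerMultiPetalSlackMonotone
import HarnessLib
import HarnessLib.Audit

/-!
# `NoHeavyLowerTail` (crux stmt-CriticalPhenomena-4575), abstract sunflower cubic, `k` petals: the INERT-COORDINATE one-point reductions
# (BOTTOM-INERT and KERNEL-INERT coordinates) for every number of petals

Support file (seat `prim-l12-p2` gen 32; `--supports stmt-CriticalPhenomena-4575`; the multi-petal port of prim-ineq-gen-2's `k = 3` classes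
`Sunflower.three_ZP_le_of_bottomInert` / `Sunflower.ZP_add_two_con_le_of_kernelInert` (`…SunflowerOnePointCertificatesB`), written on the template of
`…SunflowerMultiPetalUpperOnePetal` (p-gen 26: `chart4`, `uopIneqK`, `nested_le_nested_insert_of_upper_le_one_petal`)).  No `sorry`; nothing is asserted about the crux.
Memo: run/shared/lean/prim/prim-l12/prim-l12-p2/FINDING-g32-FLIP-SLOT-AND-SATURATED-PRIMES.md §4.5.

WHY (memo §4.5): at `n = 6` the general-`k` one-point reductions {singleton non-bottom, petal-completing, upper-one-petal} plus the Theorem-T slot bound settle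
every structure, but from `n = 7` on DUMMY-like coordinates appear (the pair structures `P_n`: `r = 3^{n-6}` rainbows, only `2^{n-6}` three-seeing spectators), and
those are exactly the INERT coordinates of the `k = 3` scan — so the general-`k` toolkit needs them.

SETTING.  `F : MSunflower k α`, a sub-cube `W`, `e ∉ W`; lower labels `x₀ = lab X`, upper labels `x₁ = lab (insert e X)` (`x₀ ≤ x₁` in `M_k`: `lab_mono`).
* **BOTTOM-INERT** (`lab X = 0 → lab (insert e X) = 0` on `2^W`): `3 · nested W (s6K ∘ lab) ≤ nested (insert e W) (s6K ∘ lab)`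
  (`MSunflower.three_mul_nested_le_nested_insert_of_bottomInert`; at `W = univ ∖ e`: `3 · ZKW (univ ∖ e) ≤ ZK`, `MSunflower.three_mul_ZKW_erase_le_ZK_of_bottomInert`).
  POINTWISE (`biIneqK`): `3·s6K x₀y₀z₀ + [x₀ petal, x₁ = ⊤]·kkK y₀z₀ + [y₀ petal, y₁ = ⊤]·kkK x₀z₀ + [z₀ petal, z₁ = ⊤]·kkK x₀y₀ ≤ s6K x₁y₀z₀ + s6K x₀y₁z₀ + s6K x₀y₀z₁`,
  and the three weighted `kkK`-sums are antipodal-Gladkov sums `≥ 0`.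
* **KERNEL-INERT** (`lab (insert e X) = ⊤ → lab X = ⊤` on `2^W`): `nested W (s6K ∘ lab) + 2 · nested W (s6K ∘ lab ∘ insert e) ≤ nested (insert e W) (s6K ∘ lab)`
  (`MSunflower.nested_add_two_mul_nested_insert_le_of_kernelInert`; the middle term is the functional of the CONTRACTION at `e` on `2^W`; at `W = univ ∖ e`:
  `MSunflower.ZKW_erase_add_two_mul_le_ZK_of_kernelInert`).  POINTWISE (`kiIneqK`): `s6K x₀y₀z₀ + 2·s6K x₁y₁z₁ + [x₀ = 0, x₁ petal]·kkK y₁z₁ + … ≤ s6K x₁y₀z₀ + s6K x₀y₁z₀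
  + s6K x₀y₀z₁`, the weighted sums being OFFSET antipodal-Gladkov sums (`pslack · {e} ≥ 0`).
The pointwise inequalities are `decide`d on `Fin 6` codes and transported to every `k` by the four-anchor chart `chart4` of `…UpperOnePetal`, anchored at the three
PAIR PETALS (`pairPetalK x₀ x₁`: under `x₀ ≤ x₁` a pair `(x₀, x₁)` carries at most one petal colour, so all six labels lie in `{0, ⊤, a, b, c}` and the chart is faithful).
Consequences (`ZK_nonneg_of_bottomInert`, `ZK_nonneg_of_kernelInert`): ★ₖ for `F` follows from ★ₖ-type nonnegativity on the smaller cube `univ ∖ e` (and, kernel-inert, of the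
contraction) — the inductive use is the caller's.
-/

namespace Summit.CriticalPhenomena.PercolationContinuityZ3.Theorems.SunflowerPartition

open Finset

variable {α : Type*} [DecidableEq α]

/-! ## Weights, pair petals -/

/-- Bottom-inert weight `[x₀ petal ∧ x₁ = ⊤]`. [this work] -/
def biWtK (k : ℕ) (x0 x1 : Fin (k + 2)) : ℤ :=
  if x0 ≠ Fin.last (k + 1) ∧ x0 ≠ 0 ∧ x1 = Fin.last (k + 1) then 1 else 0

/-- Kernel-inert weight `[x₀ = 0 ∧ x₁ petal]`. [this work] -/
def kiWtK (k : ℕ) (x0 x1 : Fin (k + 2)) : ℤ :=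
  if x0 = 0 ∧ x1 ≠ Fin.last (k + 1) ∧ x1 ≠ 0 then 1 else 0

/-- `biWtK ≥ 0`. [this work] -/
theorem biWtK_nonneg (k : ℕ) (x0 x1 : Fin (k + 2)) : 0 ≤ biWtK k x0 x1 := by
  unfold biWtK; split_ifs <;> norm_num

/-- `kiWtK ≥ 0`. [this work] -/
theorem kiWtK_nonneg (k : ℕ) (x0 x1 : Fin (k + 2)) : 0 ≤ kiWtK k x0 x1 := by
  unfold kiWtK; split_ifs <;> norm_num

/-- Transport of `biWtK` along a top/bottom-preserving relabelling. [this work] -/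
theorem biWtK_congr {k k' : ℕ} {x0 x1 : Fin (k + 2)} {x0' x1' : Fin (k' + 2)}
    (h0t : x0 = Fin.last (k + 1) ↔ x0' = Fin.last (k' + 1)) (h00 : x0 = 0 ↔ x0' = 0)
    (h1t : x1 = Fin.last (k + 1) ↔ x1' = Fin.last (k' + 1)) : biWtK k x0 x1 = biWtK k' x0' x1' := by
  unfold biWtK
  exact if_congr (and_congr (not_congr h0t) (and_congr (not_congr h00) h1t)) rfl rfl

/-- Transport of `kiWtK` along a top/bottom-preserving relabelling. [this work] -/
theorem kiWtK_congr {k k' : ℕ} {x0 x1 : Fin (k + 2)} {x0' x1' : Fin (k' + 2)}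
    (h00 : x0 = 0 ↔ x0' = 0) (h1t : x1 = Fin.last (k + 1) ↔ x1' = Fin.last (k' + 1)) (h10 : x1 = 0 ↔ x1' = 0) :
    kiWtK k x0 x1 = kiWtK k' x0' x1' := by
  unfold kiWtK
  exact if_congr (and_congr h00 (and_congr (not_congr h1t) (not_congr h10))) rfl rfl

/-- The PAIR PETAL of `(u, v)`: `u` if `u` is a petal label, else `v`. [this work] -/
def pairPetalK (k : ℕ) (u v : Fin (k + 2)) : Fin (k + 2) := if u = 0 ∨ u = Fin.last (k + 1) then v else u

/-- The lower label of a comparable pair is bottom, top or the pair petal. [this work] -/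
theorem left_mem_pairPetalK (k : ℕ) (u v : Fin (k + 2)) :
    u = Fin.last (k + 1) ∨ u = 0 ∨ u = pairPetalK k u v := by
  unfold pairPetalK
  split_ifs with h
  · rcases h with h | h
    · exact Or.inr (Or.inl h)
    · exact Or.inl h
  · exact Or.inr (Or.inr rfl)

/-- The upper label of a comparable pair (`u ≤ v` in `M_k`) is bottom, top or the pair petal. [this work] -/
theorem right_mem_pairPetalK (k : ℕ) {u v : Fin (k + 2)} (hle : u = v ∨ u = 0 ∨ v = Fin.last (k + 1)) :
    v = Fin.last (k + 1) ∨ v = 0 ∨ v = pairPetalK k u v := by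
  unfold pairPetalK
  split_ifs with h
  · exact Or.inr (Or.inr rfl)
  · rcases hle with h1 | h1 | h1
    · exact Or.inr (Or.inr h1.symm)
    · exact (h (Or.inl h1)).elim
    · exact Or.inl h1

/-! ## The two pointwise inequalities on `Fin 6` codes and for every `k` -/

/-- Bottom-inert code on `Fin 6`: `x0 ≤ x1` in `M_4` and `x0 = 0 → x1 = 0`. [this work] -/
def biCodeK6 (x0 x1 : Fin 6) : Bool := (x0 == x1 || x0 == 0 || x1 == 5) && (!(x0 == 0) || x1 == 0)

/-- Kernel-inert code on `Fin 6`: `x0 ≤ x1` in `M_4` and `x1 = ⊤ → x0 = ⊤`. [this work] -/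
def kiCodeK6 (x0 x1 : Fin 6) : Bool := (x0 == x1 || x0 == 0 || x1 == 5) && (!(x1 == 5) || x0 == 5)

/-- From the propositional conditions to the bottom-inert code. [this work] -/
theorem biCodeK6_of : ∀ a b : Fin 6, (a = b ∨ a = 0 ∨ b = 5) → (a = 0 → b = 0) → biCodeK6 a b = true := by decide

/-- From the propositional conditions to the kernel-inert code. [this work] -/
theorem kiCodeK6_of : ∀ a b : Fin 6, (a = b ∨ a = 0 ∨ b = 5) → (b = 5 → a = 5) → kiCodeK6 a b = true := by decide

/-- The bottom-inert pointwise inequality on `Fin 6` codes (`decide`). [this work] -/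
theorem biIneq6 : ∀ x0 x1 y0 y1 z0 z1 : Fin 6, biCodeK6 x0 x1 = true → biCodeK6 y0 y1 = true → biCodeK6 z0 z1 = true →
    3 * s6K 4 x0 y0 z0 + biWtK 4 x0 x1 * kkK 4 y0 z0 + biWtK 4 y0 y1 * kkK 4 x0 z0 + biWtK 4 z0 z1 * kkK 4 x0 y0
      ≤ s6K 4 x1 y0 z0 + s6K 4 x0 y1 z0 + s6K 4 x0 y0 z1 := by
  decide

/-- The kernel-inert pointwise inequality on `Fin 6` codes (`decide`). [this work] -/
theorem kiIneq6 : ∀ x0 x1 y0 y1 z0 z1 : Fin 6, kiCodeK6 x0 x1 = true → kiCodeK6 y0 y1 = true → kiCodeK6 z0 z1 = true →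
    s6K 4 x0 y0 z0 + 2 * s6K 4 x1 y1 z1 + kiWtK 4 x0 x1 * kkK 4 y1 z1 + kiWtK 4 y0 y1 * kkK 4 x1 z1 + kiWtK 4 z0 z1 * kkK 4 x1 y1
      ≤ s6K 4 x1 y0 z0 + s6K 4 x0 y1 z0 + s6K 4 x0 y0 z1 := by
  decide

section Chart

variable {k : ℕ} (x0 x1 y0 y1 z0 z1 : Fin (k + 2))

/-- The chart data at the three pair petals: top/bottom detection and faithfulness on the six labels of three comparable pairs. [this work] -/
theorem chart_pairs (hx : x0 = x1 ∨ x0 = 0 ∨ x1 = Fin.last (k + 1)) (hy : y0 = y1 ∨ y0 = 0 ∨ y1 = Fin.last (k + 1))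
    (hz : z0 = z1 ∨ z0 = 0 ∨ z1 = Fin.last (k + 1)) :
    ∃ c : Fin (k + 2) → Fin 6,
      (∀ w, w = Fin.last (k + 1) ↔ c w = Fin.last (4 + 1)) ∧ (∀ w, w = 0 ↔ c w = 0) ∧
      (∀ w', x0 = w' ↔ c x0 = c w') ∧ (∀ w', x1 = w' ↔ c x1 = c w') ∧ (∀ w', y0 = w' ↔ c y0 = c w') ∧
      (∀ w', y1 = w' ↔ c y1 = c w') ∧ (∀ w', z0 = w' ↔ c z0 = c w') ∧ (∀ w', z1 = w' ↔ c z1 = c w') := by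
  have mx0 := left_mem_pairPetalK k x0 x1
  have mx1 := right_mem_pairPetalK k hx
  have my0 := left_mem_pairPetalK k y0 y1
  have my1 := right_mem_pairPetalK k hy
  have mz0 := left_mem_pairPetalK k z0 z1
  have mz1 := right_mem_pairPetalK k hz
  generalize pairPetalK k x0 x1 = a at mx0 mx1
  generalize pairPetalK k y0 y1 = b at my0 my1
  generalize pairPetalK k z0 z1 = d at mz0 mz1
  have e5 : (5 : Fin 6) = Fin.last (4 + 1) := rfl
  refine ⟨chart4 k a b d, fun w => e5 ▸ (chart4_eq_five_iff k a b d w).symm, fun w => (chart4_eq_zero_iff k a b d w).symm, ?_⟩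
  -- the six labels are never "other"
  have nv : ∀ {u : Fin (k + 2)}, (u = Fin.last (k + 1) ∨ u = 0 ∨ u = a ∨ u = b ∨ u = d) →
      (u ≠ Fin.last (k + 1) → u ≠ 0 → u ≠ a → u ≠ b → u ≠ d → False) := by
    intro u hu h1 h2 h3 h4 h5
    rcases hu with h | h | h | h | h
    exacts [h1 h, h2 h, h3 h, h4 h, h5 h]
  have E : ∀ {w : Fin (k + 2)}, (w = Fin.last (k + 1) ∨ w = 0 ∨ w = a ∨ w = b ∨ w = d) →
      ∀ w', (w = w' ↔ chart4 k a b d w = chart4 k a b d w') :=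
    fun hw _ => chart4_eq_iff k a b d (fun t h0 ha hb hd _ _ _ _ _ => (nv hw t h0 ha hb hd).elim)
  have iA : ∀ {u : Fin (k + 2)}, (u = Fin.last (k + 1) ∨ u = 0 ∨ u = a) → (u = Fin.last (k + 1) ∨ u = 0 ∨ u = a ∨ u = b ∨ u = d) :=
    fun h => h.elim Or.inl fun h => h.elim (fun h => Or.inr (Or.inl h)) fun h => Or.inr (Or.inr (Or.inl h))
  have iB : ∀ {u : Fin (k + 2)}, (u = Fin.last (k + 1) ∨ u = 0 ∨ u = b) → (u = Fin.last (k + 1) ∨ u = 0 ∨ u = a ∨ u = b ∨ u = d) :=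
    fun h => h.elim Or.inl fun h => h.elim (fun h => Or.inr (Or.inl h)) fun h => Or.inr (Or.inr (Or.inr (Or.inl h)))
  have iD : ∀ {u : Fin (k + 2)}, (u = Fin.last (k + 1) ∨ u = 0 ∨ u = d) → (u = Fin.last (k + 1) ∨ u = 0 ∨ u = a ∨ u = b ∨ u = d) :=
    fun h => h.elim Or.inl fun h => h.elim (fun h => Or.inr (Or.inl h)) fun h => Or.inr (Or.inr (Or.inr (Or.inr h)))
  exact ⟨E (iA mx0), E (iA mx1), E (iB my0), E (iB my1), E (iD mz0), E (iD mz1)⟩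

end Chart

/-- **The bottom-inert pointwise inequality for every `k`.** [this work] -/
theorem biIneqK {k : ℕ} (x0 x1 y0 y1 z0 z1 : Fin (k + 2))
    (hx : x0 = x1 ∨ x0 = 0 ∨ x1 = Fin.last (k + 1)) (hy : y0 = y1 ∨ y0 = 0 ∨ y1 = Fin.last (k + 1))
    (hz : z0 = z1 ∨ z0 = 0 ∨ z1 = Fin.last (k + 1))
    (hx' : x0 = 0 → x1 = 0) (hy' : y0 = 0 → y1 = 0) (hz' : z0 = 0 → z1 = 0) :
    3 * s6K k x0 y0 z0 + biWtK k x0 x1 * kkK k y0 z0 + biWtK k y0 y1 * kkK k x0 z0 + biWtK k z0 z1 * kkK k x0 y0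
      ≤ s6K k x1 y0 z0 + s6K k x0 y1 z0 + s6K k x0 y0 z1 := by
  obtain ⟨c, T, Zr, Ex0, Ex1, Ey0, Ey1, Ez0, Ez1⟩ := chart_pairs x0 x1 y0 y1 z0 z1 hx hy hz
  rw [s6K_congr (T x0) (Zr x0) (T y0) (Zr y0) (T z0) (Zr z0) (Ex0 y0) (Ey0 z0) (Ex0 z0),
    biWtK_congr (T x0) (Zr x0) (T x1), kkK_congr (T y0) (Zr y0) (T z0) (Zr z0) (Ey0 z0),
    biWtK_congr (T y0) (Zr y0) (T y1), kkK_congr (T x0) (Zr x0) (T z0) (Zr z0) (Ex0 z0),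
    biWtK_congr (T z0) (Zr z0) (T z1), kkK_congr (T x0) (Zr x0) (T y0) (Zr y0) (Ex0 y0),
    s6K_congr (T x1) (Zr x1) (T y0) (Zr y0) (T z0) (Zr z0) (Ex1 y0) (Ey0 z0) (Ex1 z0),
    s6K_congr (T x0) (Zr x0) (T y1) (Zr y1) (T z0) (Zr z0) (Ex0 y1) (Ey1 z0) (Ex0 z0),
    s6K_congr (T x0) (Zr x0) (T y0) (Zr y0) (T z1) (Zr z1) (Ex0 y0) (Ey0 z1) (Ex0 z1)]
  have e5 : (5 : Fin 6) = Fin.last (4 + 1) := rfl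
  have cd : ∀ {u v : Fin (k + 2)}, (∀ w', u = w' ↔ c u = c w') → (u = v ∨ u = 0 ∨ v = Fin.last (k + 1)) → (u = 0 → v = 0) →
      biCodeK6 (c u) (c v) = true := by
    intro u v Eu h h'
    refine biCodeK6_of _ _ ?_ fun hu => (Zr v).1 (h' ((Zr u).2 hu))
    rcases h with h | h | h
    · exact Or.inl ((Eu v).1 h)
    · exact Or.inr (Or.inl ((Zr u).1 h))
    · exact Or.inr (Or.inr (e5 ▸ (T v).1 h))
  exact biIneq6 _ _ _ _ _ _ (cd Ex0 hx hx') (cd Ey0 hy hy') (cd Ez0 hz hz')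

/-- **The kernel-inert pointwise inequality for every `k`.** [this work] -/
theorem kiIneqK {k : ℕ} (x0 x1 y0 y1 z0 z1 : Fin (k + 2))
    (hx : x0 = x1 ∨ x0 = 0 ∨ x1 = Fin.last (k + 1)) (hy : y0 = y1 ∨ y0 = 0 ∨ y1 = Fin.last (k + 1))
    (hz : z0 = z1 ∨ z0 = 0 ∨ z1 = Fin.last (k + 1))
    (hx' : x1 = Fin.last (k + 1) → x0 = Fin.last (k + 1)) (hy' : y1 = Fin.last (k + 1) → y0 = Fin.last (k + 1))
    (hz' : z1 = Fin.last (k + 1) → z0 = Fin.last (k + 1)) :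
    s6K k x0 y0 z0 + 2 * s6K k x1 y1 z1 + kiWtK k x0 x1 * kkK k y1 z1 + kiWtK k y0 y1 * kkK k x1 z1 + kiWtK k z0 z1 * kkK k x1 y1
      ≤ s6K k x1 y0 z0 + s6K k x0 y1 z0 + s6K k x0 y0 z1 := by
  obtain ⟨c, T, Zr, Ex0, Ex1, Ey0, Ey1, Ez0, Ez1⟩ := chart_pairs x0 x1 y0 y1 z0 z1 hx hy hz
  rw [s6K_congr (T x0) (Zr x0) (T y0) (Zr y0) (T z0) (Zr z0) (Ex0 y0) (Ey0 z0) (Ex0 z0),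
    s6K_congr (T x1) (Zr x1) (T y1) (Zr y1) (T z1) (Zr z1) (Ex1 y1) (Ey1 z1) (Ex1 z1),
    kiWtK_congr (Zr x0) (T x1) (Zr x1), kkK_congr (T y1) (Zr y1) (T z1) (Zr z1) (Ey1 z1),
    kiWtK_congr (Zr y0) (T y1) (Zr y1), kkK_congr (T x1) (Zr x1) (T z1) (Zr z1) (Ex1 z1),
    kiWtK_congr (Zr z0) (T z1) (Zr z1), kkK_congr (T x1) (Zr x1) (T y1) (Zr y1) (Ex1 y1),
    s6K_congr (T x1) (Zr x1) (T y0) (Zr y0) (T z0) (Zr z0) (Ex1 y0) (Ey0 z0) (Ex1 z0),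
    s6K_congr (T x0) (Zr x0) (T y1) (Zr y1) (T z0) (Zr z0) (Ex0 y1) (Ey1 z0) (Ex0 z0),
    s6K_congr (T x0) (Zr x0) (T y0) (Zr y0) (T z1) (Zr z1) (Ex0 y0) (Ey0 z1) (Ex0 z1)]
  have e5 : (5 : Fin 6) = Fin.last (4 + 1) := rfl
  have cd : ∀ {u v : Fin (k + 2)}, (∀ w', u = w' ↔ c u = c w') → (u = v ∨ u = 0 ∨ v = Fin.last (k + 1)) →
      (v = Fin.last (k + 1) → u = Fin.last (k + 1)) → kiCodeK6 (c u) (c v) = true := by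
    intro u v Eu h h'
    refine kiCodeK6_of _ _ ?_ fun hv => e5 ▸ (T u).1 (h' ((T v).2 (e5 ▸ hv)))
    rcases h with h | h | h
    · exact Or.inl ((Eu v).1 h)
    · exact Or.inr (Or.inl ((Zr u).1 h))
    · exact Or.inr (Or.inr (e5 ▸ (T v).1 h))
  exact kiIneq6 _ _ _ _ _ _ (cd Ex0 hx hx') (cd Ey0 hy hy') (cd Ez0 hz hz')

/-! ## The nested (sub-cube) inequalities -/

namespace MSunflower

variable {k : ℕ} (F : MSunflower k α)

/-- Bottom-inert weighted spectator sums are antipodal-Gladkov sums, hence nonnegative. [this work] -/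
theorem nested_biWtK_kkK_nonneg (W : Finset α) (e : α) :
    0 ≤ nested W (fun X Y Z => biWtK k (F.lab X) (F.lab (insert e X)) * kkK k (F.lab Y) (F.lab Z)) := by
  unfold nested
  refine sum_nonneg fun X _ => ?_
  rw [← mul_sum]
  exact mul_nonneg (biWtK_nonneg k _ _) (F.antipodal_gladkov (W \ X))

/-- Offset antipodal Gladkov at `e`: `Σ_{S ⊆ V} kkK (lab (insert e S)) (lab (insert e (V ∖ S))) ≥ 0`. [this work] -/
theorem antipodal_gladkov_insert (V : Finset α) (e : α) :
    0 ≤ ∑ S ∈ V.powerset, kkK k (F.lab (insert e S)) (F.lab (insert e (V \ S))) := by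
  have h := F.pslack_nonneg V {e}
  unfold pslack at h
  simpa only [insert_eq] using h

/-- Kernel-inert weighted spectator sums are offset antipodal-Gladkov sums, hence nonnegative. [this work] -/
theorem nested_kiWtK_kkK_nonneg (W : Finset α) (e : α) :
    0 ≤ nested W (fun X Y Z => kiWtK k (F.lab X) (F.lab (insert e X)) * kkK k (F.lab (insert e Y)) (F.lab (insert e Z))) := by
  unfold nested
  refine sum_nonneg fun X _ => ?_
  rw [← mul_sum]
  exact mul_nonneg (kiWtK_nonneg k _ _) (F.antipodal_gladkov_insert (W \ X) e)

/-- **BOTTOM-INERT COORDINATE, every `k`** (this work): if `e ∉ W` and `lab X = 0 → lab (insert e X) = 0` for all `X ⊆ W` (no bottom set of the cube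
`2^W` leaves the bottom through `e`), then `3 · nested W (s6K ∘ lab) ≤ nested (insert e W) (s6K ∘ lab)`. [this work] -/
theorem three_mul_nested_le_nested_insert_of_bottomInert (W : Finset α) (e : α) (he : e ∉ W)
    (hbi : ∀ X ⊆ W, F.lab X = 0 → F.lab (insert e X) = 0) :
    3 * nested W (fun X Y Z => s6K k (F.lab X) (F.lab Y) (F.lab Z))
      ≤ nested (insert e W) (fun X Y Z => s6K k (F.lab X) (F.lab Y) (F.lab Z)) := by
  rw [nested_insert_split W e he]
  have h1 := F.nested_biWtK_kkK_nonneg W e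
  have h2 : 0 ≤ nested W (fun X Y Z => biWtK k (F.lab Y) (F.lab (insert e Y)) * kkK k (F.lab X) (F.lab Z)) := by
    rw [nested_swap12]; exact F.nested_biWtK_kkK_nonneg W e
  have h3 : 0 ≤ nested W (fun X Y Z => biWtK k (F.lab Z) (F.lab (insert e Z)) * kkK k (F.lab X) (F.lab Y)) := by
    rw [nested_swap23, nested_swap12]
    exact F.nested_biWtK_kkK_nonneg W e
  have h0 : 3 * nested W (fun X Y Z => s6K k (F.lab X) (F.lab Y) (F.lab Z))
      = nested W (fun X Y Z => 3 * s6K k (F.lab X) (F.lab Y) (F.lab Z)) := by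
    unfold nested
    rw [mul_sum]
    refine sum_congr rfl fun X _ => ?_
    rw [mul_sum]
  have key : nested W (fun X Y Z => 3 * s6K k (F.lab X) (F.lab Y) (F.lab Z))
      + nested W (fun X Y Z => biWtK k (F.lab X) (F.lab (insert e X)) * kkK k (F.lab Y) (F.lab Z))
      + nested W (fun X Y Z => biWtK k (F.lab Y) (F.lab (insert e Y)) * kkK k (F.lab X) (F.lab Z))
      + nested W (fun X Y Z => biWtK k (F.lab Z) (F.lab (insert e Z)) * kkK k (F.lab X) (F.lab Y))
      ≤ nested W (fun X S T => s6K k (F.lab (insert e X)) (F.lab S) (F.lab T))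
        + nested W (fun X S T => s6K k (F.lab X) (F.lab (insert e S)) (F.lab T))
        + nested W (fun X S T => s6K k (F.lab X) (F.lab S) (F.lab (insert e T))) := by
    unfold nested
    rw [← sum_add_distrib, ← sum_add_distrib, ← sum_add_distrib, ← sum_add_distrib, ← sum_add_distrib]
    refine sum_le_sum fun X hX => ?_
    rw [← sum_add_distrib, ← sum_add_distrib, ← sum_add_distrib, ← sum_add_distrib, ← sum_add_distrib]
    refine sum_le_sum fun Y hY => ?_
    have hXW : X ⊆ W := mem_powerset.1 hX
    have hYW : Y ⊆ W \ X := mem_powerset.1 hY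
    have hYW' : Y ⊆ W := fun a ha => (mem_sdiff.1 (hYW ha)).1
    have hTW : (W \ X) \ Y ⊆ W := fun a ha => (mem_sdiff.1 (mem_sdiff.1 ha).1).1
    exact biIneqK _ _ _ _ _ _ (F.lab_mono (subset_insert e X)) (F.lab_mono (subset_insert e Y))
      (F.lab_mono (subset_insert e ((W \ X) \ Y))) (hbi X hXW) (hbi Y hYW') (hbi _ hTW)
  linarith

/-- **KERNEL-INERT COORDINATE, every `k`** (this work): if `e ∉ W` and `lab (insert e X) = ⊤ → lab X = ⊤` for all `X ⊆ W` (no set of the cube `2^W`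
acquires kernel status through `e`), then `nested W (s6K ∘ lab) + 2 · nested W (s6K ∘ lab ∘ insert e) ≤ nested (insert e W) (s6K ∘ lab)` — deletion plus
twice the CONTRACTION at `e` are dominated by the full cube. [this work] -/
theorem nested_add_two_mul_nested_insert_le_of_kernelInert (W : Finset α) (e : α) (he : e ∉ W)
    (hki : ∀ X ⊆ W, F.lab (insert e X) = Fin.last (k + 1) → F.lab X = Fin.last (k + 1)) :
    nested W (fun X Y Z => s6K k (F.lab X) (F.lab Y) (F.lab Z))
      + 2 * nested W (fun X Y Z => s6K k (F.lab (insert e X)) (F.lab (insert e Y)) (F.lab (insert e Z)))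
      ≤ nested (insert e W) (fun X Y Z => s6K k (F.lab X) (F.lab Y) (F.lab Z)) := by
  rw [nested_insert_split W e he]
  have h1 := F.nested_kiWtK_kkK_nonneg W e
  have h2 : 0 ≤ nested W (fun X Y Z => kiWtK k (F.lab Y) (F.lab (insert e Y)) * kkK k (F.lab (insert e X)) (F.lab (insert e Z))) := by
    rw [nested_swap12]; exact F.nested_kiWtK_kkK_nonneg W e
  have h3 : 0 ≤ nested W (fun X Y Z => kiWtK k (F.lab Z) (F.lab (insert e Z)) * kkK k (F.lab (insert e X)) (F.lab (insert e Y))) := by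
    rw [nested_swap23, nested_swap12]
    exact F.nested_kiWtK_kkK_nonneg W e
  have h0 : 2 * nested W (fun X Y Z => s6K k (F.lab (insert e X)) (F.lab (insert e Y)) (F.lab (insert e Z)))
      = nested W (fun X Y Z => 2 * s6K k (F.lab (insert e X)) (F.lab (insert e Y)) (F.lab (insert e Z))) := by
    unfold nested
    rw [mul_sum]
    refine sum_congr rfl fun X _ => ?_
    rw [mul_sum]
  have key : nested W (fun X Y Z => s6K k (F.lab X) (F.lab Y) (F.lab Z))
      + nested W (fun X Y Z => 2 * s6K k (F.lab (insert e X)) (F.lab (insert e Y)) (F.lab (insert e Z)))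
      + nested W (fun X Y Z => kiWtK k (F.lab X) (F.lab (insert e X)) * kkK k (F.lab (insert e Y)) (F.lab (insert e Z)))
      + nested W (fun X Y Z => kiWtK k (F.lab Y) (F.lab (insert e Y)) * kkK k (F.lab (insert e X)) (F.lab (insert e Z)))
      + nested W (fun X Y Z => kiWtK k (F.lab Z) (F.lab (insert e Z)) * kkK k (F.lab (insert e X)) (F.lab (insert e Y)))
      ≤ nested W (fun X S T => s6K k (F.lab (insert e X)) (F.lab S) (F.lab T))
        + nested W (fun X S T => s6K k (F.lab X) (F.lab (insert e S)) (F.lab T))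
        + nested W (fun X S T => s6K k (F.lab X) (F.lab S) (F.lab (insert e T))) := by
    unfold nested
    rw [← sum_add_distrib, ← sum_add_distrib, ← sum_add_distrib, ← sum_add_distrib, ← sum_add_distrib, ← sum_add_distrib]
    refine sum_le_sum fun X hX => ?_
    rw [← sum_add_distrib, ← sum_add_distrib, ← sum_add_distrib, ← sum_add_distrib, ← sum_add_distrib, ← sum_add_distrib]
    refine sum_le_sum fun Y hY => ?_
    have hXW : X ⊆ W := mem_powerset.1 hX
    have hYW : Y ⊆ W \ X := mem_powerset.1 hY
    have hYW' : Y ⊆ W := fun a ha => (mem_sdiff.1 (hYW ha)).1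
    have hTW : (W \ X) \ Y ⊆ W := fun a ha => (mem_sdiff.1 (mem_sdiff.1 ha).1).1
    exact kiIneqK _ _ _ _ _ _ (F.lab_mono (subset_insert e X)) (F.lab_mono (subset_insert e Y))
      (F.lab_mono (subset_insert e ((W \ X) \ Y))) (hki X hXW) (hki Y hYW') (hki _ hTW)
  linarith

/-! ## At the top cube: `ZK` versus the cube `univ ∖ e` -/

section Top

variable [Fintype α]

/-- **BOTTOM-INERT COORDINATE at the top**: `3 · ZKW (univ ∖ e) ≤ ZK`. [this work] -/
theorem three_mul_ZKW_erase_le_ZK_of_bottomInert (e : α) (hbi : ∀ X : Finset α, e ∉ X → F.lab X = 0 → F.lab (insert e X) = 0) :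
    3 * F.ZKW (univ.erase e) ≤ F.ZK := by
  have h := F.three_mul_nested_le_nested_insert_of_bottomInert (univ.erase e) e (notMem_erase e univ)
    fun X hX h0 => hbi X (fun heX => notMem_erase e univ (hX heX)) h0
  rw [insert_erase (mem_univ e)] at h
  rw [← F.ZKW_univ]
  unfold ZKW
  exact h

/-- Hence ★ₖ for `F` at a bottom-inert coordinate follows from nonnegativity on the smaller cube. [this work] -/
theorem ZK_nonneg_of_bottomInert (e : α) (hbi : ∀ X : Finset α, e ∉ X → F.lab X = 0 → F.lab (insert e X) = 0)
    (hW : 0 ≤ F.ZKW (univ.erase e)) : 0 ≤ F.ZK :=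
  le_trans (by linarith) (F.three_mul_ZKW_erase_le_ZK_of_bottomInert e hbi)

/-- **KERNEL-INERT COORDINATE at the top**: `ZKW (univ ∖ e) + 2 · (contraction functional on univ ∖ e) ≤ ZK`. [this work] -/
theorem ZKW_erase_add_two_mul_le_ZK_of_kernelInert (e : α)
    (hki : ∀ X : Finset α, e ∉ X → F.lab (insert e X) = Fin.last (k + 1) → F.lab X = Fin.last (k + 1)) :
    F.ZKW (univ.erase e)
      + 2 * nested (univ.erase e) (fun X Y Z => s6K k (F.lab (insert e X)) (F.lab (insert e Y)) (F.lab (insert e Z)))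
      ≤ F.ZK := by
  have h := F.nested_add_two_mul_nested_insert_le_of_kernelInert (univ.erase e) e (notMem_erase e univ)
    fun X hX h0 => hki X (fun heX => notMem_erase e univ (hX heX)) h0
  rw [insert_erase (mem_univ e)] at h
  rw [← F.ZKW_univ]
  unfold ZKW
  exact h

/-- Hence ★ₖ for `F` at a kernel-inert coordinate follows from nonnegativity of the deletion AND of the contraction on the smaller cube. [this work] -/
theorem ZK_nonneg_of_kernelInert (e : α)
    (hki : ∀ X : Finset α, e ∉ X → F.lab (insert e X) = Fin.last (k + 1) → F.lab X = Fin.last (k + 1))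
    (hW : 0 ≤ F.ZKW (univ.erase e))
    (hC : 0 ≤ nested (univ.erase e) (fun X Y Z => s6K k (F.lab (insert e X)) (F.lab (insert e Y)) (F.lab (insert e Z)))) :
    0 ≤ F.ZK :=
  le_trans (by linarith) (F.ZKW_erase_add_two_mul_le_ZK_of_kernelInert e hki)

end Top

end MSunflower

end Summit.CriticalPhenomena.PercolationContinuityZ3.Theorems.SunflowerPartition
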